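import Literature.NumberTheory.EllipticCurves.PadicSeriesEvaluationNormedAlgebra
import Literature.NumberTheory.EllipticCurves.FormalGroupDictionaryProofs
import HarnessLib

/-!
# The formal group of a Weierstrass curve over `ℚ_p` at points of a complete ultrametric normed
# `ℚ_p`-algebra `L`: the dictionary `E₁(L) → Ê(𝓜_L)` (proofs only)

Trunk T-NT-EC (`Literature/NumberTheory/EllipticCurves`). Pure proof file (no definitions, no named
facts): the pointwise half of `FormalGroupDictionaryProofs.lean` (Silverman AEC IV.1 p. 116 /
VII.2.2: «the map `𝓜 → E(K)`, `z ↦ (x(z), y(z))` … has inverse `(x, y) ↦ −x/y`») VERBATIM with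
the points taken in `E(L) = (V ⊗ L)(L)` for a complete ultrametric normed `ℚ_p`-algebra field `L`
(e.g. `ℂ_p`) instead of `E(ℚ_p)`, the series still being those of `V/ℚ_p` (`p`-integral) and the
values taken by `padicAlgEval L` (`PadicSeriesEvaluationNormedAlgebra.lean`). This is the first
pointwise brick (A2) of the existence proof of the canonical cyclotomic `p`-adic height over a number
field `H` with `p` possibly ramified (`CanonicalPAdicHeightCyc.lean`), where the points are the
images in `E(ℂ_p)` of points of `E(H)` under the embeddings `H → ℂ_p`.

PROVED (for `V/ℚ_p` with `p`-integral coefficients and `P = (x, y) ∈ (V ⊗ L)(L)` with `‖x‖ > 1`,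
`z = −x/y`): `norm_sq_eq_norm_cube_alg` (`‖y‖² = ‖x‖³`, `‖x‖ < ‖y‖`), `param_facts_alg`
(`y ≠ 0`, `z ≠ 0`, `‖z‖ < 1`, `‖1/y‖ < 1`, `y + a₁x + a₃ ≠ 0`), `one_lt_norm_x_of_one_lt_norm_y_alg`,
`padicAlgEval_formalW_eq` (**`w(z(P)) = −1/y(P)`**, AEC IV.1.1(b): both are fixed points of the
contraction `w ↦ f(z, w)` in the open unit disc), `padicAlgEval_formalXMulSq_eq`
(`z²x(z)|_{z(P)} = x·z(P)²`), `padicAlgEval_formalNeg_eq` (`i(z(P)) = z(−P)`).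

## Sources

* J. H. Silverman, *The Arithmetic of Elliptic Curves*, 2nd ed. (2009), IV.1.1 and its proof
  (pp. 115–116, for ANY complete local ring `R` and `z ∈ 𝓜`), IV.1 pp. 116–118, VII.2.2.
-/

noncomputable section

open PowerSeries Literature.NumberTheory.EllipticCurves

namespace WeierstrassCurve

variable {p : ℕ} [Fact p.Prime] (V : WeierstrassCurve ℚ_[p]) [hV : V.IsIntegral ℤ_[p]]
  (L : Type*) [NontriviallyNormedField L] [NormedAlgebra ℚ_[p] L] [IsUltrametricDist L]

/-! ### Norms: coefficients, `‖y‖² = ‖x‖³` -/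

omit [IsUltrametricDist L] in
/-- `‖aᵢ‖ ≤ 1` for the coefficients of `V ⊗ L`, `V` `p`-integral. [cite: SilvermanAEC2009, VII.1 Remark 1.1] -/
theorem norm_coeffs_baseChange_le_one :
    ‖(V.baseChange L).a₁‖ ≤ 1 ∧ ‖(V.baseChange L).a₂‖ ≤ 1 ∧ ‖(V.baseChange L).a₃‖ ≤ 1 ∧
      ‖(V.baseChange L).a₄‖ ≤ 1 ∧ ‖(V.baseChange L).a₆‖ ≤ 1 := by
  obtain ⟨h₁, h₂, h₃, h₄, h₆⟩ := V.norm_coeffs_le_one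
  refine ⟨?_, ?_, ?_, ?_, ?_⟩
  · show ‖algebraMap ℚ_[p] L V.a₁‖ ≤ 1; rw [norm_algebraMap']; exact h₁
  · show ‖algebraMap ℚ_[p] L V.a₂‖ ≤ 1; rw [norm_algebraMap']; exact h₂
  · show ‖algebraMap ℚ_[p] L V.a₃‖ ≤ 1; rw [norm_algebraMap']; exact h₃
  · show ‖algebraMap ℚ_[p] L V.a₄‖ ≤ 1; rw [norm_algebraMap']; exact h₄
  · show ‖algebraMap ℚ_[p] L V.a₆‖ ≤ 1; rw [norm_algebraMap']; exact h₆

variable {L}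

/-- Ultrametric bookkeeping: `‖a‖ < 1`, `‖b‖ < 1 ⇒ ‖a + b‖ < 1`. [folklore] -/
private theorem norm_add_lt_one' {a b : L} (ha : ‖a‖ < 1) (hb : ‖b‖ < 1) : ‖a + b‖ < 1 :=
  (IsUltrametricDist.norm_add_le_max _ _).trans_lt (max_lt ha hb)

omit [IsUltrametricDist L] in
/-- `‖a‖ ≤ 1`, `‖b‖ < 1 ⇒ ‖a b‖ < 1`. [folklore] -/
private theorem norm_mul_lt_one' {a b : L} (ha : ‖a‖ ≤ 1) (hb : ‖b‖ < 1) : ‖a * b‖ < 1 := by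
  rw [norm_mul]; exact mul_lt_one_of_nonneg_of_lt_one_right ha (norm_nonneg _) hb

/-- **`‖y‖² = ‖x‖³` and `‖y‖ > ‖x‖` for `(x, y) ∈ E(L)` with `‖x‖ > 1`** on a `p`-integral
equation (the cubic term dominates the right-hand side, so `y²` must dominate the left).
[cite: SilvermanAEC2009, VII.2.2] -/
theorem norm_sq_eq_norm_cube_alg {x y : L} (heq : (V.baseChange L).toAffine.Equation x y)
    (hx : 1 < ‖x‖) : ‖y‖ ^ 2 = ‖x‖ ^ 3 ∧ ‖x‖ < ‖y‖ := by
  obtain ⟨h₁, h₂, h₃, h₄, h₆⟩ := V.norm_coeffs_baseChange_le_one L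
  set A := V.baseChange L with hA
  rw [Affine.equation_iff] at heq
  change y ^ 2 + A.a₁ * x * y + A.a₃ * y = x ^ 3 + A.a₂ * x ^ 2 + A.a₄ * x + A.a₆ at heq
  have hx0 : 0 < ‖x‖ := one_pos.trans hx
  have hx1 : 1 ≤ ‖x‖ := hx.le
  have hx2 : ‖x‖ ≤ ‖x‖ ^ 2 := by nlinarith
  have hx3 : ‖x‖ ^ 2 < ‖x‖ ^ 3 := by nlinarith
  have hr : ‖A.a₂ * x ^ 2 + A.a₄ * x + A.a₆‖ ≤ ‖x‖ ^ 2 := by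
    refine (IsUltrametricDist.norm_add_le_max _ _).trans (max_le
      ((IsUltrametricDist.norm_add_le_max _ _).trans (max_le ?_ ?_)) (h₆.trans (one_le_pow₀ hx1)))
    · rw [norm_mul, norm_pow]; exact mul_le_of_le_one_left (by positivity) h₂
    · rw [norm_mul]; exact (mul_le_of_le_one_left (norm_nonneg _) h₄).trans hx2
  have hR : ‖x ^ 3 + A.a₂ * x ^ 2 + A.a₄ * x + A.a₆‖ = ‖x‖ ^ 3 := by
    rw [show x ^ 3 + A.a₂ * x ^ 2 + A.a₄ * x + A.a₆ = x ^ 3 + (A.a₂ * x ^ 2 + A.a₄ * x + A.a₆)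
      by ring, IsUltrametricDist.norm_add_eq_max_of_norm_ne_norm, norm_pow,
      max_eq_left (hr.trans hx3.le)]
    rw [norm_pow]; exact (ne_of_lt (hr.trans_lt hx3)).symm
  have hy : ‖x‖ < ‖y‖ := by
    by_contra hle
    push Not at hle
    have hL : ‖y ^ 2 + A.a₁ * x * y + A.a₃ * y‖ ≤ ‖x‖ ^ 2 := by
      refine (IsUltrametricDist.norm_add_le_max _ _).trans (max_le
        ((IsUltrametricDist.norm_add_le_max _ _).trans (max_le ?_ ?_)) ?_)
      · rw [norm_pow]; exact pow_le_pow_left₀ (norm_nonneg _) hle 2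
      · rw [norm_mul, norm_mul, sq]
        exact mul_le_mul (mul_le_of_le_one_left (norm_nonneg _) h₁) hle (norm_nonneg _)
          (norm_nonneg _)
      · rw [norm_mul]
        exact ((mul_le_of_le_one_left (norm_nonneg _) h₃).trans hle).trans hx2
    rw [heq, hR] at hL
    exact absurd hL (not_le.mpr hx3)
  have hy0 : 0 < ‖y‖ := hx0.trans hy
  have hl : ‖A.a₁ * x * y + A.a₃ * y‖ < ‖y‖ ^ 2 := by
    refine (IsUltrametricDist.norm_add_le_max _ _).trans_lt (max_lt ?_ ?_)
    · rw [norm_mul, norm_mul, sq]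
      exact mul_lt_mul_of_pos_right ((mul_le_of_le_one_left (norm_nonneg _) h₁).trans_lt hy) hy0
    · rw [norm_mul, sq]
      exact mul_lt_mul_of_pos_right (h₃.trans_lt (hx.trans hy)) hy0
  have hL : ‖y ^ 2 + A.a₁ * x * y + A.a₃ * y‖ = ‖y‖ ^ 2 := by
    rw [add_assoc, IsUltrametricDist.norm_add_eq_max_of_norm_ne_norm, norm_pow, max_eq_left hl.le]
    rw [norm_pow]; exact (ne_of_lt hl).symm
  exact ⟨by rw [← hL, heq, hR], hy⟩

/-- Consequences for the parameter: `y ≠ 0`, `z = −x/y ≠ 0`, `‖z‖ < 1`, `‖1/y‖ < 1`, and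
`y + a₁x + a₃ ≠ 0`. [cite: SilvermanAEC2009, VII.2.2] -/
theorem param_facts_alg {x y : L} (heq : (V.baseChange L).toAffine.Equation x y) (hx : 1 < ‖x‖) :
    y ≠ 0 ∧ -x / y ≠ 0 ∧ ‖-x / y‖ < 1 ∧ ‖-1 / y‖ < 1 ∧
      y + (V.baseChange L).a₁ * x + (V.baseChange L).a₃ ≠ 0 := by
  obtain ⟨h₁, -, h₃, -, -⟩ := V.norm_coeffs_baseChange_le_one L
  obtain ⟨hsq, hxy⟩ := V.norm_sq_eq_norm_cube_alg heq hx
  have hx0 : 0 < ‖x‖ := one_pos.trans hx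
  have hy1 : 1 < ‖y‖ := hx.trans hxy
  have hy0 : y ≠ 0 := fun h => by rw [h, norm_zero] at hy1; exact not_lt.mpr zero_le_one hy1
  have hxne : x ≠ 0 := fun h => by rw [h, norm_zero] at hx0; exact lt_irrefl _ hx0
  refine ⟨hy0, div_ne_zero (neg_ne_zero.mpr hxne) hy0, ?_, ?_, ?_⟩
  · rw [norm_div, norm_neg, div_lt_one (hx0.trans hxy)]; exact hxy
  · rw [norm_div, norm_neg, norm_one, div_lt_one (one_pos.trans hy1)]; exact hy1
  · intro h0
    have : ‖y‖ = ‖(V.baseChange L).a₁ * x + (V.baseChange L).a₃‖ := by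
      rw [show y = -((V.baseChange L).a₁ * x + (V.baseChange L).a₃) by linear_combination h0,
        norm_neg]
    have hlt : ‖(V.baseChange L).a₁ * x + (V.baseChange L).a₃‖ < ‖y‖ :=
      (IsUltrametricDist.norm_add_le_max _ _).trans_lt (max_lt (by
        rw [norm_mul]; exact (mul_le_of_le_one_left (norm_nonneg _) h₁).trans_lt hxy)
        (h₃.trans_lt hy1))
    rw [← this] at hlt
    exact lt_irrefl _ hlt

/-- On a `p`-integral equation, `‖y‖ > 1` forces `‖x‖ > 1` (the `y²` term dominates the left
side). [cite: SilvermanAEC2009, VII.2.2] -/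
theorem one_lt_norm_x_of_one_lt_norm_y_alg {x y : L} (heq : (V.baseChange L).toAffine.Equation x y)
    (hy : 1 < ‖y‖) : 1 < ‖x‖ := by
  obtain ⟨h₁, h₂, h₃, h₄, h₆⟩ := V.norm_coeffs_baseChange_le_one L
  set A := V.baseChange L with hA
  by_contra hx
  push Not at hx
  rw [Affine.equation_iff] at heq
  change y ^ 2 + A.a₁ * x * y + A.a₃ * y = x ^ 3 + A.a₂ * x ^ 2 + A.a₄ * x + A.a₆ at heq
  have hy0 : 0 < ‖y‖ := one_pos.trans hy
  have hR : ‖x ^ 3 + A.a₂ * x ^ 2 + A.a₄ * x + A.a₆‖ ≤ 1 := by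
    refine (IsUltrametricDist.norm_add_le_max _ _).trans (max_le
      ((IsUltrametricDist.norm_add_le_max _ _).trans (max_le
        ((IsUltrametricDist.norm_add_le_max _ _).trans (max_le ?_ ?_)) ?_)) h₆)
    · rw [norm_pow]; exact pow_le_one₀ (norm_nonneg _) hx
    · rw [norm_mul, norm_pow]
      exact mul_le_one₀ h₂ (by positivity) (pow_le_one₀ (norm_nonneg _) hx)
    · rw [norm_mul]; exact mul_le_one₀ h₄ (norm_nonneg _) hx
  have hl : ‖A.a₁ * x * y + A.a₃ * y‖ < ‖y‖ ^ 2 := by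
    have hyy : ‖y‖ < ‖y‖ ^ 2 := by nlinarith
    refine (IsUltrametricDist.norm_add_le_max _ _).trans_lt (max_lt ?_ ?_)
    · rw [norm_mul, norm_mul]
      calc ‖A.a₁‖ * ‖x‖ * ‖y‖ ≤ 1 * 1 * ‖y‖ := by gcongr
        _ = ‖y‖ := by ring
        _ < ‖y‖ ^ 2 := hyy
    · rw [norm_mul]
      calc ‖A.a₃‖ * ‖y‖ ≤ 1 * ‖y‖ := by gcongr
        _ = ‖y‖ := by ring
        _ < ‖y‖ ^ 2 := hyy
  have hL : ‖y ^ 2 + A.a₁ * x * y + A.a₃ * y‖ = ‖y‖ ^ 2 := by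
    rw [add_assoc, IsUltrametricDist.norm_add_eq_max_of_norm_ne_norm, norm_pow, max_eq_left hl.le]
    rw [norm_pow]; exact (ne_of_lt hl).symm
  have hy2 : ‖y‖ ^ 2 ≤ 1 := by rw [← hL, heq]; exact hR
  nlinarith

/-! ### The dictionary `E₁(L) → Ê(𝓜_L)`: `w(z(P)) = −1/y(P)` -/

variable [CompleteSpace L]

/-- **AEC VII.2.2 / IV.1.1(b) at an `L`-point: `w(z(P)) = −1/y(P)`** for `P = (x, y) ∈ E(L)` with
`‖x‖ > 1` on a `p`-integral equation `V/ℚ_p`. Both `w(z(P))` (evaluate the fixed-point identity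
of `w(z)` in `𝒪_L`) and `w₀ = −1/y` (the Weierstrass equation divided by `y³`) are fixed points of
`w ↦ f(z, w)` in the open unit disc, where `f(z, ·)` is a contraction: `w₀ − ŵ = (w₀ − ŵ)β`,
`‖β‖ < 1`. [cite: SilvermanAEC2009, VII.2.2] [cite: SilvermanAEC2009, IV.1.1] -/
theorem padicAlgEval_formalW_eq {x y : L} (heq : (V.baseChange L).toAffine.Equation x y)
    (hx : 1 < ‖x‖) : padicAlgEval L V.formalW (-x / y) = -1 / y := by
  obtain ⟨h₁, h₂, h₃, h₄, h₆⟩ := V.norm_coeffs_baseChange_le_one L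
  obtain ⟨hy0, hz0, hz1, hw1, -⟩ := V.param_facts_alg heq hx
  set A := V.baseChange L with hA
  have ea₁ : algebraMap ℚ_[p] L V.a₁ = A.a₁ := rfl
  have ea₂ : algebraMap ℚ_[p] L V.a₂ = A.a₂ := rfl
  have ea₃ : algebraMap ℚ_[p] L V.a₃ = A.a₃ := rfl
  have ea₄ : algebraMap ℚ_[p] L V.a₄ = A.a₄ := rfl
  have ea₆ : algebraMap ℚ_[p] L V.a₆ = A.a₆ := rfl
  set z : L := -x / y with hzdef
  set w₀ : L := -1 / y with hw₀def
  set ŵ : L := padicAlgEval L V.formalW z with hŵdef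
  -- (i) `ŵ` is a fixed point: evaluate `w = f(z, w)` (AEC IV.1.1(a)) with the evaluation calculus
  have hfix : ŵ = z ^ 3 + A.a₁ * z * ŵ + A.a₂ * z ^ 2 * ŵ + A.a₃ * ŵ ^ 2 + A.a₄ * z * ŵ ^ 2 +
      A.a₆ * ŵ ^ 3 := by
    obtain ⟨i₁, i₂, i₃, i₄, i₆⟩ := V.norm_coeffs_le_one
    have hW := V.isPadicInt_formalW
    have hXi : IsPadicInt (PowerSeries.X : ℚ_[p]⟦X⟧) := IsPadicInt.powerSeries_X
    have key := congrArg (fun g => padicAlgEval L g z) V.formalWStep_formalW.symm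
    simp only [formalWStep] at key
    -- expand the right-hand side term by term
    have t1 : IsPadicInt ((PowerSeries.X : ℚ_[p]⟦X⟧) ^ 3) := hXi.pow 3
    have t2 : IsPadicInt (C V.a₁ * X * V.formalW) := ((IsPadicInt.powerSeries_C i₁).mul hXi).mul hW
    have t3 : IsPadicInt (C V.a₂ * X ^ 2 * V.formalW) :=
      ((IsPadicInt.powerSeries_C i₂).mul (hXi.pow 2)).mul hW
    have t4 : IsPadicInt (C V.a₃ * V.formalW ^ 2) := (IsPadicInt.powerSeries_C i₃).mul (hW.pow 2)
    have t5 : IsPadicInt (C V.a₄ * X * V.formalW ^ 2) :=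
      ((IsPadicInt.powerSeries_C i₄).mul hXi).mul (hW.pow 2)
    have t6 : IsPadicInt (C V.a₆ * V.formalW ^ 3) := (IsPadicInt.powerSeries_C i₆).mul (hW.pow 3)
    rw [padicAlgEval_add ((((t1.add t2).add t3).add t4).add t5) t6 hz1,
      padicAlgEval_add (((t1.add t2).add t3).add t4) t5 hz1,
      padicAlgEval_add ((t1.add t2).add t3) t4 hz1, padicAlgEval_add (t1.add t2) t3 hz1,
      padicAlgEval_add t1 t2 hz1, padicAlgEval_pow hXi hz1,
      padicAlgEval_mul ((IsPadicInt.powerSeries_C i₁).mul hXi) hW hz1,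
      padicAlgEval_mul (IsPadicInt.powerSeries_C i₁) hXi hz1,
      padicAlgEval_mul ((IsPadicInt.powerSeries_C i₂).mul (hXi.pow 2)) hW hz1,
      padicAlgEval_mul (IsPadicInt.powerSeries_C i₂) (hXi.pow 2) hz1, padicAlgEval_pow hXi hz1,
      padicAlgEval_mul (IsPadicInt.powerSeries_C i₃) (hW.pow 2) hz1, padicAlgEval_pow hW hz1,
      padicAlgEval_mul ((IsPadicInt.powerSeries_C i₄).mul hXi) (hW.pow 2) hz1,
      padicAlgEval_mul (IsPadicInt.powerSeries_C i₄) hXi hz1, padicAlgEval_pow hW hz1,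
      padicAlgEval_mul (IsPadicInt.powerSeries_C i₆) (hW.pow 3) hz1, padicAlgEval_pow hW hz1,
      padicAlgEval_X, padicAlgEval_C, padicAlgEval_C, padicAlgEval_C, padicAlgEval_C, padicAlgEval_C,
      ea₁, ea₂, ea₃, ea₄, ea₆] at key
    exact key
  -- (ii) `w₀ = −1/y` is a fixed point (the Weierstrass equation divided by `y³`)
  have hw0 : w₀ = z ^ 3 + A.a₁ * z * w₀ + A.a₂ * z ^ 2 * w₀ + A.a₃ * w₀ ^ 2 + A.a₄ * z * w₀ ^ 2 +
      A.a₆ * w₀ ^ 3 := by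
    rw [Affine.equation_iff] at heq
    change y ^ 2 + A.a₁ * x * y + A.a₃ * y = x ^ 3 + A.a₂ * x ^ 2 + A.a₄ * x + A.a₆ at heq
    rw [hzdef, hw₀def]
    field_simp
    linear_combination (-1 : L) * heq
  -- (iii) both lie in the open unit disc
  have hŵ1 : ‖ŵ‖ < 1 := norm_padicAlgEval_lt_one V.isPadicInt_formalW V.constantCoeff_formalW hz1
  -- (iv) contraction
  set β : L := A.a₁ * z + A.a₂ * z ^ 2 + A.a₃ * (w₀ + ŵ) + A.a₄ * z * (w₀ + ŵ) +
    A.a₆ * (w₀ ^ 2 + w₀ * ŵ + ŵ ^ 2) with hβ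
  have hβ1 : ‖β‖ < 1 := by
    have hz1' : ‖z‖ ≤ 1 := hz1.le
    have hs : ‖w₀ + ŵ‖ < 1 := norm_add_lt_one' hw1 hŵ1
    refine norm_add_lt_one' (norm_add_lt_one' (norm_add_lt_one'
      (norm_add_lt_one' (norm_mul_lt_one' h₁ hz1) ?_) (norm_mul_lt_one' h₃ hs)) ?_) ?_
    · exact norm_mul_lt_one' h₂ (by rw [norm_pow]; exact pow_lt_one₀ (norm_nonneg _) hz1 two_ne_zero)
    · rw [mul_assoc]; exact norm_mul_lt_one' h₄ (norm_mul_lt_one' hz1' hs)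
    · refine norm_mul_lt_one' h₆ (norm_add_lt_one' (norm_add_lt_one' ?_ ?_) ?_)
      · rw [norm_pow]; exact pow_lt_one₀ (norm_nonneg _) hw1 two_ne_zero
      · exact norm_mul_lt_one' hw1.le hŵ1
      · rw [norm_pow]; exact pow_lt_one₀ (norm_nonneg _) hŵ1 two_ne_zero
  have hprod : (w₀ - ŵ) * (1 - β) = 0 := by
    rw [hβ]; linear_combination hw0 - hfix
  have hne : (1 : L) - β ≠ 0 := by
    intro h0
    rw [sub_eq_zero] at h0
    rw [← h0, norm_one] at hβ1
    exact lt_irrefl _ hβ1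
  have := (mul_eq_zero.mp hprod).resolve_right hne
  rw [sub_eq_zero] at this
  exact this.symm

/-- **`z² x(z)` at `z(P)` is `x(P) z(P)²`** (`x = z/w`) for an `L`-point with `‖x‖ > 1`.
[cite: SilvermanAEC2009, VII.2.2] -/
theorem padicAlgEval_formalXMulSq_eq {x y : L} (heq : (V.baseChange L).toAffine.Equation x y)
    (hx : 1 < ‖x‖) : padicAlgEval L V.formalXMulSq (-x / y) = x * (-x / y) ^ 2 := by
  obtain ⟨hy0, hz0, hz1, -, -⟩ := V.param_facts_alg heq hx
  have hw := V.padicAlgEval_formalW_eq heq hx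
  have hB : padicAlgEval L V.formalWDivCube (-x / y) * (-x / y) ^ 3 = -1 / y := by
    rw [← hw, V.formalW_eq_X_pow_mul_formalWDivCube,
      padicAlgEval_mul (IsPadicInt.powerSeries_X.pow 3) V.isPadicInt_formalWDivCube hz1,
      padicAlgEval_pow IsPadicInt.powerSeries_X hz1, padicAlgEval_X, mul_comm]
  rw [padicAlgEval_eq_inv_of_mul_eq_one V.isPadicInt_formalWDivCube V.isPadicInt_formalXMulSq
    V.formalWDivCube_mul_formalXMulSq hz1]
  have hBv : padicAlgEval L V.formalWDivCube (-x / y) = (-1 / y) / (-x / y) ^ 3 := by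
    rw [eq_div_iff (pow_ne_zero 3 hz0)]; exact hB
  rw [hBv, inv_div]
  field_simp

/-- **`i(z(P)) = z(−P)`** for an `L`-point with `‖x‖ > 1`: the formal inverse evaluates to the
parameter of `−P = (x, −y − a₁x − a₃)`. [cite: SilvermanAEC2009, IV.1.1] -/
theorem padicAlgEval_formalNeg_eq {x y : L} (heq : (V.baseChange L).toAffine.Equation x y)
    (hx : 1 < ‖x‖) :
    padicAlgEval L V.formalNeg (-x / y) = -x / (V.baseChange L).toAffine.negY x y := by
  obtain ⟨hy0, hz0, hz1, -, hneg⟩ := V.param_facts_alg heq hx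
  have hw := V.padicAlgEval_formalW_eq heq hx
  have ea₁ : algebraMap ℚ_[p] L V.a₁ = (V.baseChange L).a₁ := rfl
  have ea₃ : algebraMap ℚ_[p] L V.a₃ = (V.baseChange L).a₃ := rfl
  have hg : constantCoeff (1 - C V.a₁ * X - C V.a₃ * V.formalW) = 1 := by
    simp [V.constantCoeff_formalW]
  have hgi : (1 - C V.a₁ * X - C V.a₃ * V.formalW) * invOfUnit (1 - C V.a₁ * X - C V.a₃ * V.formalW) 1
      = 1 := mul_invOfUnit _ 1 (by rw [hg, Units.val_one])
  have hge : padicAlgEval L (1 - C V.a₁ * X - C V.a₃ * V.formalW) (-x / y) =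
      1 - (V.baseChange L).a₁ * (-x / y) - (V.baseChange L).a₃ * (-1 / y) := by
    have hc₁ := IsPadicInt.powerSeries_C V.norm_coeffs_le_one.1
    have hc₃ := IsPadicInt.powerSeries_C V.norm_coeffs_le_one.2.2.1
    rw [padicAlgEval_sub (IsPadicInt.one.sub (hc₁.mul IsPadicInt.powerSeries_X))
        (hc₃.mul V.isPadicInt_formalW) hz1,
      padicAlgEval_sub IsPadicInt.one (hc₁.mul IsPadicInt.powerSeries_X) hz1,
      padicAlgEval_mul hc₁ IsPadicInt.powerSeries_X hz1, padicAlgEval_mul hc₃ V.isPadicInt_formalW hz1,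
      padicAlgEval_one, padicAlgEval_C, padicAlgEval_C, padicAlgEval_X, hw, ea₁, ea₃]
  rw [formalNeg, padicAlgEval_neg (IsPadicInt.powerSeries_X.mul V.isPadicInt_invOfUnit_formalNegDenom)
    hz1, padicAlgEval_mul IsPadicInt.powerSeries_X V.isPadicInt_invOfUnit_formalNegDenom hz1,
    padicAlgEval_X, padicAlgEval_eq_inv_of_mul_eq_one V.isPadicInt_formalNegDenom
    V.isPadicInt_invOfUnit_formalNegDenom hgi hz1, hge, Affine.negY]
  have hden : 1 - (V.baseChange L).a₁ * (-x / y) - (V.baseChange L).a₃ * (-1 / y) =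
      (y + (V.baseChange L).a₁ * x + (V.baseChange L).a₃) / y := by
    field_simp; ring
  rw [hden, inv_div, show -y - (V.baseChange L).a₁ * x - (V.baseChange L).a₃ =
    -(y + (V.baseChange L).a₁ * x + (V.baseChange L).a₃) by ring, neg_div_neg_eq]
  field_simp

end WeierstrassCurve

end
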